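import Summits.QuantumFields.YangMills.Theorems.AlphaInputsT3ACv3StepLowWeightedPins
import Summits.QuantumFields.YangMills.Theorems.AlphaInputsT3ACv3StepLowCharge
import HarnessLib

/-!
# `AlphaInputsT3ACv3StepLowWeightedT3` — THE T³ LOWER-ROW KNITS WITH AN ABSTRACT SMALL-FIELD WEIGHT `wt`: size line discharged, a.e. positivity, and the CHARGING road on the charging set
# `O_ε ∩ {wt ≠ 0}` (the weight-generic editions of ✓`fibre57LowOnAC_T3_of_le_gamma` ∕ ✓`…_of_ae_pos` ∕ ✓`hpos_ae_of_hcharge` ∕ ✓`…_of_hcharge`; cell `ym3-torus`, (α)-row #23, the post-freeze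
# (R7) slot∕cut docket; seat `ym3-torus-px20` g14 — DOOR 4 part 2 of 2, ★★OWNER g37 WORD №123; `--supports stmt-QuantumFields-19936 --as helper`)

WHAT.  ✓`AlphaInputsT3ACv3StepLowWeightedPins` re-typed the lower-row pins road for an abstract weight `wt` in the fluctuation integrand (`hdom ↦ hwtlo`).  THIS FILE carries the weight
through the T³ knits VERBATIM: §1 `fibre57LowOnAC_T3_of_le_gamma_weight` (size line from `hγs`); §2 `…_of_ae_pos_weight` (pointwise `hpos` ↦ a.e.); §3 `hpos_ae_of_hcharge_weight` (a.e. positivity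
from F2c's chart identity and the CHARGING LETTER on `O_ε ∩ {wt ≠ 0}`); §4 ★★★ `fibre57LowOnAC_T3_of_le_gamma_of_hcharge_weight` — the socket where any (R7) lower pin docks (`wt = χB·𝟙[loPrintAC k]`:
`hcharge` = ✓door 3 `hcharge_loPrintAC_of_floor`, `hloinv` = ✓door 1; assembled in the sequel `…WeightedPrint`).

HONEST SCOPE.  [folklore] bookkeeping — four landed proofs re-run with an abstract weight; def-free; weighted pins and `hcharge` are HYPOTHESES; nothing of #22∕#23, `hdom`, (47)∕(57), the (α)
data rows (0∕23), (O‴χₛ), `HistoryTailL` (19936), EX, LOWB∘ or `YM3TorusSU2` is proved (rung R3 = SU(2) YM₃ on T³, a RECORD rung: NOT d = 4, NOT infinite volume, NOT a mass gap, NOT Clay; the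
Yang–Mills mass gap is NOT proved).  L-floor: none beyond the family's.
References: T. Bałaban, Commun. Math. Phys. **102** (1985) 255–275 [Balaban1985UV3] ((22) p.261, (37) p.265, (47) p.267, (49)–(58) pp.268–270, p.272 L32–33); **109** (1987) 249–301
[Balaban1987RG1] ((0.4) p.253).
-/

set_option autoImplicit false

noncomputable section

namespace Summit.QuantumFields.YangMills.Theorems.PinnedStepTrivPins

open MeasureTheory Set Literature.MathematicalPhysics.QuantumFieldTheory.Balaban1983to89
open Literature.MathematicalPhysics.QuantumFieldTheory.Balaban1983to89.GaugeField (GaugeInvariant gaugeAct)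
open Literature.MathematicalPhysics.QuantumFieldTheory.Balaban1983to89.BlockAveraging (avgFun loopHol Idx measurable_avgFun)
open Literature.MathematicalPhysics.QuantumFieldTheory.Balaban1983to89.ExpMeanLog (expMeanLogSU measurable_expMeanLogSU_E)
open Literature.MathematicalPhysics.QuantumFieldTheory.Balaban1983to89.T3ContinuumYM3Torus (T3Family)
open Literature.MathematicalPhysics.QuantumFieldTheory.Balaban1983to89.T3UnitScaleTilt (θBal)
open Literature.MathematicalPhysics.QuantumFieldTheory.Balaban1985CMP102 Literature.MathematicalPhysics.QuantumFieldTheory.Balaban1985CMP102.Setting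
open Summit.QuantumFields.Balaban3D.Carriers
open Summit.QuantumFields.Balaban3D.Proofs.Primitives (AlphaConsts)
open Summit.QuantumFields.Balaban3D.Proofs.Thresholds (Q0 Q0_pos)
open Summit.QuantumFields.Balaban3D.Proofs.TowerAC Summit.QuantumFields.Balaban3D.Proofs.StandardAC Summit.QuantumFields.Balaban3D.Proofs.InputsAC
open Summit.QuantumFields.Balaban3D.Proofs.Bound55Masses (chiB chiB_nonneg chiB_le_one measurable_chiB)
open Summit.QuantumFields.Balaban3D.Proofs.GaussianNormalization (partZ normalized integral_exp_neg_mul_eq)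
open Summit.QuantumFields.YangMills.Theorems.PinnedStep (wtP Fibre55WinAC Fibre57LowOnAC)
open scoped NNReal ENNReal

variable {F : T3Family} (𝔠 : AlphaConsts F.L (suGroupModel 2).N) {γ : ℝ} {hγ : 0 < γ} {hγ1' : γ ≤ 1} {K : ℕ}
  {Val : Type} [NormedAddCommGroup Val] [NormedSpace ℂ Val]
  (X : ExternalInputsAC (T3Scales F γ hγ hγ1' K) (Matrix.specialUnitaryGroup (Fin 2) ℂ))
  (𝔖 : ∀ k, StepSeries (T3Scales F γ hγ hγ1' K) (Matrix.specialUnitaryGroup (Fin 2) ℂ) Val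
    (nblkOf (T3Scales F γ hγ hγ1' K) 𝔠.lane.carrier k) k)


/-- ★★ **THE `wt`-WEIGHTED LOWER ROW AT THE T³ RECORD, SIZE LINE DISCHARGED** — ✓`fibre57LowOnAC_T3_of_le_gamma` VERBATIM with the abstract weight `wt` in the pins (`χB ↦ wt`,
`hdom ↦ {hwtm hwt0 hwt1 hwtinv hwtχ hwtlo}`). [cite: Balaban1985UV3, (37) p.265 + (47) p.267 + (55)–(58) pp.269–270 + p.272 L32–33] -/
theorem fibre57LowOnAC_T3_of_le_gamma_weight (hγs : γ ≤ ((((4500 : ℝ) * (F.L : ℝ) ^ 5)⁻¹ / (𝔠.b₀ * Q0 𝔠.p₀)) ^ 2) ^ 2)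
    (lo : (k : ℕ) → Set (GaugeField (F.P K) k (Matrix.specialUnitaryGroup (Fin 2) ℂ))) (k : ℕ) (hk : k ≤ K)
    (hav : (X.av k).avg = avgFun (expMeanLogSU (n := Fin 2)))
    (Φ : GaugeField (F.P K) (k + 1) (Matrix.specialUnitaryGroup (Fin 2) ℂ) × GaugeField (F.P K) k (Matrix.specialUnitaryGroup (Fin 2) ℂ) →
      GaugeField (F.P K) k (Matrix.specialUnitaryGroup (Fin 2) ℂ))
    (J : GaugeField (F.P K) (k + 1) (Matrix.specialUnitaryGroup (Fin 2) ℂ) × GaugeField (F.P K) k (Matrix.specialUnitaryGroup (Fin 2) ℂ) → ℝ≥0)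
    (T : Set (GaugeField (F.P K) (k + 1) (Matrix.specialUnitaryGroup (Fin 2) ℂ) × GaugeField (F.P K) k (Matrix.specialUnitaryGroup (Fin 2) ℂ)))
    (hΦ : Measurable Φ) (hJ : Measurable J) (hT : MeasurableSet T)
    (hmap : ((((fieldMeasure (F.P K) (k + 1) (Matrix.specialUnitaryGroup (Fin 2) ℂ)).prod
        (fieldMeasure (F.P K) k (Matrix.specialUnitaryGroup (Fin 2) ℂ))).restrict T).withDensity (fun z => (J z : ℝ≥0∞))).map Φ =
      (fieldMeasure (F.P K) k (Matrix.specialUnitaryGroup (Fin 2) ℂ)).restrict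
        {U : GaugeField (F.P K) k (Matrix.specialUnitaryGroup (Fin 2) ℂ) |
          ∀ c i, dist1 (loopHol U c i) < ((Fintype.card (Idx (F.P K)) : ℝ))⁻¹ / 10})
    (hfib : ∀ z ∈ T, avgFun (expMeanLogSU (n := Fin 2)) (Φ z) = z.1) (N lσ dg : ℝ)
    (q : GaugeField (F.P K) (k + 1) (Matrix.specialUnitaryGroup (Fin 2) ℂ) → GaugeField (F.P K) k (Matrix.specialUnitaryGroup (Fin 2) ℂ) → ℝ)
    (hqm : ∀ V, Measurable (q V)) (hZ : ∀ V, 0 < partZ (fieldMeasure (F.P K) k (Matrix.specialUnitaryGroup (Fin 2) ℂ)) (q V))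
    (hU : Measurable (X.UkH k (Hist.triv (F.P K) k))) (hPm : Measurable ((inputOfAC 𝔠.lane X 𝔖).Pint k (Hist.triv (F.P K) k)))
    (cP : ℝ) (hPb : ∀ U, (inputOfAC 𝔠.lane X 𝔖).Pint k (Hist.triv (F.P K) k) U ≤ cP)
    (hinv : GaugeInvariant (fun U : GaugeField (F.P K) k (Matrix.specialUnitaryGroup (Fin 2) ℂ) =>
      Real.exp (-((towerOfAC 𝔠.lane X 𝔖).mainT k (Hist.triv (F.P K) k) U) + (towerOfAC 𝔠.lane X 𝔖).Pint k (Hist.triv (F.P K) k) U)))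
    (hlom : MeasurableSet (lo k))
    (hloinv : ∀ (u : GaugeTransf (F.P K) k (Matrix.specialUnitaryGroup (Fin 2) ℂ)) (U : GaugeField (F.P K) k (Matrix.specialUnitaryGroup (Fin 2) ℂ)),
      gaugeAct u U ∈ lo k ↔ U ∈ lo k)
    (wt : GaugeField (F.P K) k (Matrix.specialUnitaryGroup (Fin 2) ℂ) → ℝ) (hwtm : Measurable wt) (hwt0 : ∀ U, 0 ≤ wt U) (hwt1 : ∀ U, wt U ≤ 1)
    (hwtinv : GaugeInvariant wt)
    (hwtχ : ∀ U : GaugeField (F.P K) k (Matrix.specialUnitaryGroup (Fin 2) ℂ), wt U ≠ 0 →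
      chiB 𝔠.lane.carrier.M₁ (rcolOf (T3Scales F γ hγ hγ1' K) 𝔠.lane.carrier) (eps1Of (T3Scales F γ hγ hγ1' K) 𝔠.lane.carrier) k (Hist.triv (F.P K) (k + 1)) U ≠ 0)
    (hwtlo : ∀ U : GaugeField (F.P K) k (Matrix.specialUnitaryGroup (Fin 2) ℂ), wt U ≠ 0 → U ∈ lo k)
    (hσ : (piecesAC 𝔠.lane X 𝔖 k).logσ₀ = lσ) (hdg : (piecesAC 𝔠.lane X 𝔖 k).dg = dg)
    (hstar : (piecesAC 𝔠.lane X 𝔖 k).starB (Hist.triv (F.P K) (k + 1)) = N)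
    (hZU : ∀ V, (piecesAC 𝔠.lane X 𝔖 k).logZU (Hist.triv (F.P K) (k + 1)) V =
      Real.log (partZ (fieldMeasure (F.P K) k (Matrix.specialUnitaryGroup (Fin 2) ℂ)) (q V)))
    (hFl : ∀ V, (piecesAC 𝔠.lane X 𝔖 k).logFl (Hist.triv (F.P K) (k + 1)) V =
      Real.log (∫ U', (Real.exp (-((lσ + dg * Real.log ((T3Scales F γ hγ hγ1' K).gk k)) * N)) * T.indicator (fun z => (J z : ℝ)) (V, U')) *
              wt (Φ (V, U')) *
              Real.exp (-((towerOfAC 𝔠.lane X 𝔖).mainT k (Hist.triv (F.P K) k) (Φ (V, U')) -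
                    (towerOfAC 𝔠.lane X 𝔖).mainT (k + 1) (Hist.triv (F.P K) (k + 1)) V)
                + ((towerOfAC 𝔠.lane X 𝔖).Pint k (Hist.triv (F.P K) k) (Φ (V, U')) - (piecesAC 𝔠.lane X 𝔖 k).Pold (Hist.triv (F.P K) (k + 1)) V)
                + q V U')
            ∂(normalized (fieldMeasure (F.P K) k (Matrix.specialUnitaryGroup (Fin 2) ℂ)) (q V))))
    (hpos : ∀ V, V ∈ lo (k + 1) →
      0 < ∫ U', (Real.exp (-((lσ + dg * Real.log ((T3Scales F γ hγ hγ1' K).gk k)) * N)) * T.indicator (fun z => (J z : ℝ)) (V, U')) *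
              wt (Φ (V, U')) *
              Real.exp (-((towerOfAC 𝔠.lane X 𝔖).mainT k (Hist.triv (F.P K) k) (Φ (V, U')) -
                    (towerOfAC 𝔠.lane X 𝔖).mainT (k + 1) (Hist.triv (F.P K) (k + 1)) V)
                + ((towerOfAC 𝔠.lane X 𝔖).Pint k (Hist.triv (F.P K) k) (Φ (V, U')) - (piecesAC 𝔠.lane X 𝔖 k).Pold (Hist.triv (F.P K) (k + 1)) V)
                + q V U')
            ∂(normalized (fieldMeasure (F.P K) k (Matrix.specialUnitaryGroup (Fin 2) ℂ)) (q V))) :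
    Fibre57LowOnAC 𝔠.lane X 𝔖 lo k := by
  have hsize := sizeLine_T3_of_le_gamma (𝔠 := 𝔠) γ hγ hγ1' hγs K k hk
  exact fibre57LowOnAC_of_blockAvgChart_weight 𝔠.lane X 𝔖 lo k hav hsize.1 hsize.2 Φ J T hΦ hJ hT hmap hfib N lσ dg q hqm hZ hU hPm cP hPb hinv
    hlom hloinv wt hwtm hwt0 hwt1 hwtinv hwtχ hwtlo hσ hdg hstar hZU hFl hpos


/-- ★★ **THE `wt`-WEIGHTED LOWER ROW WITH THE a.e. POSITIVITY LETTER** — ✓`fibre57LowOnAC_T3_of_le_gamma_of_ae_pos` VERBATIM with the abstract weight `wt`.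
[cite: Balaban1985UV3, (47) p.267 + (55)–(58) pp.269–270 + p.272 L32–33] -/
theorem fibre57LowOnAC_T3_of_le_gamma_of_ae_pos_weight (hγs : γ ≤ ((((4500 : ℝ) * (F.L : ℝ) ^ 5)⁻¹ / (𝔠.b₀ * Q0 𝔠.p₀)) ^ 2) ^ 2)
    (lo : (k : ℕ) → Set (GaugeField (F.P K) k (Matrix.specialUnitaryGroup (Fin 2) ℂ))) (k : ℕ) (hk : k ≤ K)
    (hav : (X.av k).avg = avgFun (expMeanLogSU (n := Fin 2)))
    (Φ : GaugeField (F.P K) (k + 1) (Matrix.specialUnitaryGroup (Fin 2) ℂ) × GaugeField (F.P K) k (Matrix.specialUnitaryGroup (Fin 2) ℂ) →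
      GaugeField (F.P K) k (Matrix.specialUnitaryGroup (Fin 2) ℂ))
    (J : GaugeField (F.P K) (k + 1) (Matrix.specialUnitaryGroup (Fin 2) ℂ) × GaugeField (F.P K) k (Matrix.specialUnitaryGroup (Fin 2) ℂ) → ℝ≥0)
    (T : Set (GaugeField (F.P K) (k + 1) (Matrix.specialUnitaryGroup (Fin 2) ℂ) × GaugeField (F.P K) k (Matrix.specialUnitaryGroup (Fin 2) ℂ)))
    (hΦ : Measurable Φ) (hJ : Measurable J) (hT : MeasurableSet T)
    (hmap : ((((fieldMeasure (F.P K) (k + 1) (Matrix.specialUnitaryGroup (Fin 2) ℂ)).prod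
        (fieldMeasure (F.P K) k (Matrix.specialUnitaryGroup (Fin 2) ℂ))).restrict T).withDensity (fun z => (J z : ℝ≥0∞))).map Φ =
      (fieldMeasure (F.P K) k (Matrix.specialUnitaryGroup (Fin 2) ℂ)).restrict
        {U : GaugeField (F.P K) k (Matrix.specialUnitaryGroup (Fin 2) ℂ) |
          ∀ c i, dist1 (loopHol U c i) < ((Fintype.card (Idx (F.P K)) : ℝ))⁻¹ / 10})
    (hfib : ∀ z ∈ T, avgFun (expMeanLogSU (n := Fin 2)) (Φ z) = z.1) (N lσ dg : ℝ)
    (q : GaugeField (F.P K) (k + 1) (Matrix.specialUnitaryGroup (Fin 2) ℂ) → GaugeField (F.P K) k (Matrix.specialUnitaryGroup (Fin 2) ℂ) → ℝ)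
    (hqm : ∀ V, Measurable (q V)) (hZ : ∀ V, 0 < partZ (fieldMeasure (F.P K) k (Matrix.specialUnitaryGroup (Fin 2) ℂ)) (q V))
    (hU : Measurable (X.UkH k (Hist.triv (F.P K) k))) (hPm : Measurable ((inputOfAC 𝔠.lane X 𝔖).Pint k (Hist.triv (F.P K) k)))
    (cP : ℝ) (hPb : ∀ U, (inputOfAC 𝔠.lane X 𝔖).Pint k (Hist.triv (F.P K) k) U ≤ cP)
    (hinv : GaugeInvariant (fun U : GaugeField (F.P K) k (Matrix.specialUnitaryGroup (Fin 2) ℂ) =>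
      Real.exp (-((towerOfAC 𝔠.lane X 𝔖).mainT k (Hist.triv (F.P K) k) U) + (towerOfAC 𝔠.lane X 𝔖).Pint k (Hist.triv (F.P K) k) U)))
    (hlom : MeasurableSet (lo k))
    (hloinv : ∀ (u : GaugeTransf (F.P K) k (Matrix.specialUnitaryGroup (Fin 2) ℂ)) (U : GaugeField (F.P K) k (Matrix.specialUnitaryGroup (Fin 2) ℂ)),
      gaugeAct u U ∈ lo k ↔ U ∈ lo k)
    (wt : GaugeField (F.P K) k (Matrix.specialUnitaryGroup (Fin 2) ℂ) → ℝ) (hwtm : Measurable wt) (hwt0 : ∀ U, 0 ≤ wt U) (hwt1 : ∀ U, wt U ≤ 1)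
    (hwtinv : GaugeInvariant wt)
    (hwtχ : ∀ U : GaugeField (F.P K) k (Matrix.specialUnitaryGroup (Fin 2) ℂ), wt U ≠ 0 →
      chiB 𝔠.lane.carrier.M₁ (rcolOf (T3Scales F γ hγ hγ1' K) 𝔠.lane.carrier) (eps1Of (T3Scales F γ hγ hγ1' K) 𝔠.lane.carrier) k (Hist.triv (F.P K) (k + 1)) U ≠ 0)
    (hwtlo : ∀ U : GaugeField (F.P K) k (Matrix.specialUnitaryGroup (Fin 2) ℂ), wt U ≠ 0 → U ∈ lo k)
    (hσ : (piecesAC 𝔠.lane X 𝔖 k).logσ₀ = lσ) (hdg : (piecesAC 𝔠.lane X 𝔖 k).dg = dg)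
    (hstar : (piecesAC 𝔠.lane X 𝔖 k).starB (Hist.triv (F.P K) (k + 1)) = N)
    (hZU : ∀ V, (piecesAC 𝔠.lane X 𝔖 k).logZU (Hist.triv (F.P K) (k + 1)) V =
      Real.log (partZ (fieldMeasure (F.P K) k (Matrix.specialUnitaryGroup (Fin 2) ℂ)) (q V)))
    (hFl : ∀ V, (piecesAC 𝔠.lane X 𝔖 k).logFl (Hist.triv (F.P K) (k + 1)) V =
      Real.log (∫ U', (Real.exp (-((lσ + dg * Real.log ((T3Scales F γ hγ hγ1' K).gk k)) * N)) * T.indicator (fun z => (J z : ℝ)) (V, U')) *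
              wt (Φ (V, U')) *
              Real.exp (-((towerOfAC 𝔠.lane X 𝔖).mainT k (Hist.triv (F.P K) k) (Φ (V, U')) -
                    (towerOfAC 𝔠.lane X 𝔖).mainT (k + 1) (Hist.triv (F.P K) (k + 1)) V)
                + ((towerOfAC 𝔠.lane X 𝔖).Pint k (Hist.triv (F.P K) k) (Φ (V, U')) - (piecesAC 𝔠.lane X 𝔖 k).Pold (Hist.triv (F.P K) (k + 1)) V)
                + q V U')
            ∂(normalized (fieldMeasure (F.P K) k (Matrix.specialUnitaryGroup (Fin 2) ℂ)) (q V))))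
    (hpos_ae : ∀ᵐ V ∂(fieldMeasure (F.P K) (k + 1) (Matrix.specialUnitaryGroup (Fin 2) ℂ)), V ∈ lo (k + 1) →
      0 < ∫ U', (Real.exp (-((lσ + dg * Real.log ((T3Scales F γ hγ hγ1' K).gk k)) * N)) * T.indicator (fun z => (J z : ℝ)) (V, U')) *
              wt (Φ (V, U')) *
              Real.exp (-((towerOfAC 𝔠.lane X 𝔖).mainT k (Hist.triv (F.P K) k) (Φ (V, U')) -
                    (towerOfAC 𝔠.lane X 𝔖).mainT (k + 1) (Hist.triv (F.P K) (k + 1)) V)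
                + ((towerOfAC 𝔠.lane X 𝔖).Pint k (Hist.triv (F.P K) k) (Φ (V, U')) - (piecesAC 𝔠.lane X 𝔖 k).Pold (Hist.triv (F.P K) (k + 1)) V)
                + q V U')
            ∂(normalized (fieldMeasure (F.P K) k (Matrix.specialUnitaryGroup (Fin 2) ℂ)) (q V))) :
    Fibre57LowOnAC 𝔠.lane X 𝔖 lo k := by
  classical
  -- the positivity set of the chart fibre integral at level `k + 1`
  set Pset : Set (GaugeField (F.P K) (k + 1) (Matrix.specialUnitaryGroup (Fin 2) ℂ)) :=
    {V | 0 < ∫ U', (Real.exp (-((lσ + dg * Real.log ((T3Scales F γ hγ hγ1' K).gk k)) * N)) * T.indicator (fun z => (J z : ℝ)) (V, U')) *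
                  wt (Φ (V, U')) *
                  Real.exp (-((towerOfAC 𝔠.lane X 𝔖).mainT k (Hist.triv (F.P K) k) (Φ (V, U')) -
                        (towerOfAC 𝔠.lane X 𝔖).mainT (k + 1) (Hist.triv (F.P K) (k + 1)) V)
                    + ((towerOfAC 𝔠.lane X 𝔖).Pint k (Hist.triv (F.P K) k) (Φ (V, U')) - (piecesAC 𝔠.lane X 𝔖 k).Pold (Hist.triv (F.P K) (k + 1)) V)
                    + q V U')
                ∂(normalized (fieldMeasure (F.P K) k (Matrix.specialUnitaryGroup (Fin 2) ℂ)) (q V))} with hPset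
  have hne : k ≠ k + 1 := by omega
  have hk' : Function.update lo (k + 1) (lo (k + 1) ∩ Pset) k = lo k := Function.update_of_ne hne _ _
  have h' := fibre57LowOnAC_T3_of_le_gamma_weight 𝔠 X 𝔖 hγs (Function.update lo (k + 1) (lo (k + 1) ∩ Pset)) k hk hav Φ J T hΦ hJ hT hmap
    hfib N lσ dg q hqm hZ hU hPm cP hPb hinv (by rw [hk']; exact hlom) (fun u U => by rw [hk']; exact hloinv u U)
    wt hwtm hwt0 hwt1 hwtinv hwtχ (fun U hU0 => by rw [hk']; exact hwtlo U hU0) hσ hdg hstar hZU hFl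
    (fun V hV => by rw [Function.update_self] at hV; exact hV.2)
  refine PinnedStep.fibre57LowOnAC_of_ae_subset_left 𝔠.lane X 𝔖 k hk' ?_ h'
  filter_upwards [hpos_ae] with V hV hm
  rw [Function.update_self]
  exact ⟨hm, hV hm⟩


/-- ★★ **THE a.e. POSITIVITY LETTER FROM THE CHART IDENTITY AND THE CHARGING LETTER, ABSTRACT WEIGHT** — ✓`hpos_ae_of_hcharge` VERBATIM with `χB ↦ wt` (charging set `O_ε ∩ {wt ≠ 0}`;
`wt` measurable, in `[0,1]`, gauge invariant — for the weight's measurability∕bound through ✓`trivIntegrand_props`). [cite: Balaban1985UV3, (22) p.261 + (49)–(58) pp.268–270 + p.272 L32–33] -/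
theorem hpos_ae_of_hcharge_weight (lo : (k : ℕ) → Set (GaugeField (F.P K) k (Matrix.specialUnitaryGroup (Fin 2) ℂ))) (k : ℕ)
    (Φ : GaugeField (F.P K) (k + 1) (Matrix.specialUnitaryGroup (Fin 2) ℂ) × GaugeField (F.P K) k (Matrix.specialUnitaryGroup (Fin 2) ℂ) → GaugeField (F.P K) k (Matrix.specialUnitaryGroup (Fin 2) ℂ))
    (J : GaugeField (F.P K) (k + 1) (Matrix.specialUnitaryGroup (Fin 2) ℂ) × GaugeField (F.P K) k (Matrix.specialUnitaryGroup (Fin 2) ℂ) → ℝ≥0)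
    (T : Set (GaugeField (F.P K) (k + 1) (Matrix.specialUnitaryGroup (Fin 2) ℂ) × GaugeField (F.P K) k (Matrix.specialUnitaryGroup (Fin 2) ℂ)))
    (hΦ : Measurable Φ) (hJ : Measurable J) (hT : MeasurableSet T)
    (hmap : ((((fieldMeasure (F.P K) (k + 1) (Matrix.specialUnitaryGroup (Fin 2) ℂ)).prod
        (fieldMeasure (F.P K) k (Matrix.specialUnitaryGroup (Fin 2) ℂ))).restrict T).withDensity (fun z => (J z : ℝ≥0∞))).map Φ =
      (fieldMeasure (F.P K) k (Matrix.specialUnitaryGroup (Fin 2) ℂ)).restrict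
        {U : GaugeField (F.P K) k (Matrix.specialUnitaryGroup (Fin 2) ℂ) | ∀ c i, dist1 (loopHol U c i) < ((Fintype.card (Idx (F.P K)) : ℝ))⁻¹ / 10})
    (hfib : ∀ z ∈ T, avgFun (expMeanLogSU (n := Fin 2)) (Φ z) = z.1) (N lσ dg : ℝ)
    (q : GaugeField (F.P K) (k + 1) (Matrix.specialUnitaryGroup (Fin 2) ℂ) → GaugeField (F.P K) k (Matrix.specialUnitaryGroup (Fin 2) ℂ) → ℝ)
    (hqm : ∀ V, Measurable (q V)) (hZ : ∀ V, 0 < partZ (fieldMeasure (F.P K) k (Matrix.specialUnitaryGroup (Fin 2) ℂ)) (q V))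
    (hU : Measurable (X.UkH k (Hist.triv (F.P K) k))) (hPm : Measurable ((inputOfAC 𝔠.lane X 𝔖).Pint k (Hist.triv (F.P K) k)))
    (cP : ℝ) (hPb : ∀ U, (inputOfAC 𝔠.lane X 𝔖).Pint k (Hist.triv (F.P K) k) U ≤ cP)
    (hinv : GaugeInvariant (fun U : GaugeField (F.P K) k (Matrix.specialUnitaryGroup (Fin 2) ℂ) =>
      Real.exp (-((towerOfAC 𝔠.lane X 𝔖).mainT k (Hist.triv (F.P K) k) U) + (towerOfAC 𝔠.lane X 𝔖).Pint k (Hist.triv (F.P K) k) U)))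
    (wt : GaugeField (F.P K) k (Matrix.specialUnitaryGroup (Fin 2) ℂ) → ℝ) (hwtm : Measurable wt) (hwt0 : ∀ U, 0 ≤ wt U) (hwt1 : ∀ U, wt U ≤ 1)
    (hwtinv : GaugeInvariant wt)
    (hlom₁ : MeasurableSet (lo (k + 1)))
    (hcharge : ∀ Nset : Set (GaugeField (F.P K) (k + 1) (Matrix.specialUnitaryGroup (Fin 2) ℂ)), MeasurableSet Nset → Nset ⊆ lo (k + 1) →
      fieldMeasure (F.P K) k (Matrix.specialUnitaryGroup (Fin 2) ℂ)
        ({U : GaugeField (F.P K) k (Matrix.specialUnitaryGroup (Fin 2) ℂ) | ∀ c i, dist1 (loopHol U c i) < ((Fintype.card (Idx (F.P K)) : ℝ))⁻¹ / 10} ∩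
          {U | wt U ≠ 0} ∩
          (avgFun (expMeanLogSU (n := Fin 2))) ⁻¹' Nset) = 0 →
      fieldMeasure (F.P K) (k + 1) (Matrix.specialUnitaryGroup (Fin 2) ℂ) Nset = 0) :
    ∀ᵐ V ∂(fieldMeasure (F.P K) (k + 1) (Matrix.specialUnitaryGroup (Fin 2) ℂ)), V ∈ lo (k + 1) →
      0 < ∫ U', (Real.exp (-((lσ + dg * Real.log ((T3Scales F γ hγ hγ1' K).gk k)) * N)) * T.indicator (fun z => (J z : ℝ)) (V, U')) *
              wt (Φ (V, U')) *
              Real.exp (-((towerOfAC 𝔠.lane X 𝔖).mainT k (Hist.triv (F.P K) k) (Φ (V, U')) -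
                    (towerOfAC 𝔠.lane X 𝔖).mainT (k + 1) (Hist.triv (F.P K) (k + 1)) V)
                + ((towerOfAC 𝔠.lane X 𝔖).Pint k (Hist.triv (F.P K) k) (Φ (V, U')) - (piecesAC 𝔠.lane X 𝔖 k).Pold (Hist.triv (F.P K) (k + 1)) V)
                + q V U')
            ∂(normalized (fieldMeasure (F.P K) k (Matrix.specialUnitaryGroup (Fin 2) ℂ)) (q V)) := by
  classical
  -- abbreviations
  set μ₁ : Measure (GaugeField (F.P K) (k + 1) (Matrix.specialUnitaryGroup (Fin 2) ℂ)) := fieldMeasure (F.P K) (k + 1) (Matrix.specialUnitaryGroup (Fin 2) ℂ) with hμ₁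
  set μ₀ : Measure (GaugeField (F.P K) k (Matrix.specialUnitaryGroup (Fin 2) ℂ)) := fieldMeasure (F.P K) k (Matrix.specialUnitaryGroup (Fin 2) ℂ) with hμ₀
  set O : Set (GaugeField (F.P K) k (Matrix.specialUnitaryGroup (Fin 2) ℂ)) :=
    {U | ∀ c i, dist1 (loopHol U c i) < ((Fintype.card (Idx (F.P K)) : ℝ))⁻¹ / 10} with hO
  set χ₀ : GaugeField (F.P K) k (Matrix.specialUnitaryGroup (Fin 2) ℂ) → ℝ := wt with hχ₀
  have hχm : Measurable χ₀ := hwtm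
  set C : Set (GaugeField (F.P K) k (Matrix.specialUnitaryGroup (Fin 2) ℂ)) := {U | χ₀ U ≠ 0} with hC
  have hCm : MeasurableSet C := hχm (measurableSet_singleton (0 : ℝ)).compl
  have havg : Measurable (avgFun (expMeanLogSU (n := Fin 2)) : GaugeField (F.P K) k (Matrix.specialUnitaryGroup (Fin 2) ℂ) → GaugeField (F.P K) (k + 1) (Matrix.specialUnitaryGroup (Fin 2) ℂ)) :=
    measurable_avgFun _ measurable_expMeanLogSU_E
  -- §A the generic a.e. positivity of the `(T, J, C)` fibre integrals
  have hae := PinnedStep.ae_pos_lintegral_fibre_of_map_eq_of_charge μ₁ μ₀ Φ J T O (avgFun (expMeanLogSU (n := Fin 2)))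
    hΦ hJ hT havg hmap hfib hCm hlom₁ hcharge
  -- §B a.e. finiteness of the `(T, J)` fibre integrals (total mass `μ₀ O ≤ 1`)
  have hJm : Measurable fun z : GaugeField (F.P K) (k + 1) (Matrix.specialUnitaryGroup (Fin 2) ℂ) × GaugeField (F.P K) k (Matrix.specialUnitaryGroup (Fin 2) ℂ) => (J z : ℝ≥0∞) :=
    measurable_coe_nnreal_ennreal.comp hJ
  have hgm : Measurable (T.indicator fun z : GaugeField (F.P K) (k + 1) (Matrix.specialUnitaryGroup (Fin 2) ℂ) × GaugeField (F.P K) k (Matrix.specialUnitaryGroup (Fin 2) ℂ) => (J z : ℝ≥0∞)) :=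
    hJm.indicator hT
  have hfin : ∀ᵐ V ∂μ₁, ∫⁻ U', T.indicator (fun z => (J z : ℝ≥0∞)) (V, U') ∂μ₀ < ∞ := by
    refine ae_lt_top hgm.lintegral_prod_right' (ne_of_lt ?_)
    calc ∫⁻ V, ∫⁻ U', T.indicator (fun z => (J z : ℝ≥0∞)) (V, U') ∂μ₀ ∂μ₁
        = ∫⁻ z, T.indicator (fun z => (J z : ℝ≥0∞)) z ∂(μ₁.prod μ₀) := (lintegral_prod _ hgm.aemeasurable).symm
      _ = (((μ₁.prod μ₀).restrict T).withDensity (fun z => (J z : ℝ≥0∞))) Set.univ := by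
          rw [withDensity_apply _ MeasurableSet.univ, Measure.restrict_univ, lintegral_indicator hT]
      _ = ((((μ₁.prod μ₀).restrict T).withDensity (fun z => (J z : ℝ≥0∞))).map Φ) Set.univ := by
          rw [Measure.map_apply hΦ MeasurableSet.univ, Set.preimage_univ]
      _ = μ₀ O := by rw [hmap, Measure.restrict_apply_univ]
      _ < ∞ := measure_lt_top _ _
  -- §C combine at a.e. `V`
  filter_upwards [hae, hfin] with V hposV hfinV hVlo
  have hp := hposV hVlo
  -- the level-`k` weight `w := χ₀ · e^{−mainT_k + Pint_k + c}` with `c := mainT_{k+1}(V) − Pold(V)`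
  set m₁ : ℝ := (towerOfAC 𝔠.lane X 𝔖).mainT (k + 1) (Hist.triv (F.P K) (k + 1)) V with hm₁
  set Po : ℝ := (piecesAC 𝔠.lane X 𝔖 k).Pold (Hist.triv (F.P K) (k + 1)) V with hPo
  obtain ⟨hwm, hwb, -⟩ := trivIntegrand_props 𝔠.lane X 𝔖 k hU hPm cP hPb hinv χ₀ hχm hwt0 hwt1 hwtinv (m₁ - Po)
  set w : GaugeField (F.P K) k (Matrix.specialUnitaryGroup (Fin 2) ℂ) → ℝ := fun U => χ₀ U *
    Real.exp (-((towerOfAC 𝔠.lane X 𝔖).mainT k (Hist.triv (F.P K) k) U) + (towerOfAC 𝔠.lane X 𝔖).Pint k (Hist.triv (F.P K) k) U + (m₁ - Po)) with hw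
  have hw0 : ∀ U, 0 ≤ w U := fun U => mul_nonneg (hwt0 U) (Real.exp_pos _).le
  -- the `μ₀`-integrand `H := 𝟙_T J (V,·) · w (Φ (V,·))` is integrable and has positive integral
  set H : GaugeField (F.P K) k (Matrix.specialUnitaryGroup (Fin 2) ℂ) → ℝ := fun U' => T.indicator (fun z => (J z : ℝ)) (V, U') * w (Φ (V, U')) with hH
  have hind : ∀ U', T.indicator (fun z => (J z : ℝ)) (V, U') = (T.indicator (fun z => (J z : ℝ≥0∞)) (V, U')).toReal := fun U' => by
    by_cases h : (V, U') ∈ T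
    · rw [Set.indicator_of_mem h, Set.indicator_of_mem h, ENNReal.coe_toReal]
    · rw [Set.indicator_of_notMem h, Set.indicator_of_notMem h, ENNReal.toReal_zero]
  have hJi : Integrable (fun U' => T.indicator (fun z => (J z : ℝ)) (V, U')) μ₀ := by
    have h := integrable_toReal_of_lintegral_ne_top (hgm.comp measurable_prodMk_left).aemeasurable (ne_of_lt hfinV)
    exact h.congr (Filter.Eventually.of_forall fun U' => (hind U').symm)
  have hHi : Integrable H μ₀ :=
    hJi.mul_bdd ((hwm.comp (hΦ.comp measurable_prodMk_left)).aestronglyMeasurable)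
      (Filter.Eventually.of_forall fun U' => by rw [Real.norm_eq_abs]; exact hwb _)
  have hH0 : ∀ U', 0 ≤ H U' := fun U' => mul_nonneg (by
    by_cases h : (V, U') ∈ T
    · rw [Set.indicator_of_mem h]; exact (J _).coe_nonneg
    · rw [Set.indicator_of_notMem h]) (hw0 _)
  have hHpos : 0 < ∫ U', H U' ∂μ₀ := by
    rw [integral_pos_iff_support_of_nonneg_ae (Filter.Eventually.of_forall hH0) hHi]
    -- the `(T, J, C)` integrand is not a.e. zero, and its support lies in that of `H`
    have hgV : Measurable fun U' => T.indicator (fun z => (J z : ℝ≥0∞)) (V, U') * C.indicator (fun _ => (1 : ℝ≥0∞)) (Φ (V, U')) :=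
      (hgm.comp measurable_prodMk_left).mul ((measurable_const.indicator hCm).comp (hΦ.comp measurable_prodMk_left))
    have hne : μ₀ {U' | T.indicator (fun z => (J z : ℝ≥0∞)) (V, U') * C.indicator (fun _ => (1 : ℝ≥0∞)) (Φ (V, U')) ≠ 0} ≠ 0 := by
      intro h0
      have hae0 : (fun U' => T.indicator (fun z => (J z : ℝ≥0∞)) (V, U') * C.indicator (fun _ => (1 : ℝ≥0∞)) (Φ (V, U'))) =ᵐ[μ₀] 0 :=
        ae_iff.2 (by simpa using h0)
      exact (ne_of_gt hp) ((lintegral_eq_zero_iff hgV).2 hae0)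
    refine lt_of_lt_of_le (pos_iff_ne_zero.2 hne) (measure_mono fun U' hU' => ?_)
    -- membership transfer
    simp only [Set.mem_setOf_eq, ne_eq, mul_eq_zero, not_or] at hU'
    obtain ⟨hTJ, hCΦ⟩ := hU'
    have hzT : (V, U') ∈ T := by
      by_contra h; exact hTJ (by rw [Set.indicator_of_notMem h])
    have hJne : (J (V, U') : ℝ) ≠ 0 := by
      intro h0; apply hTJ
      rw [Set.indicator_of_mem hzT, ENNReal.coe_eq_zero]
      exact_mod_cast h0
    have hΦC : Φ (V, U') ∈ C := by
      by_contra h; exact hCΦ (by rw [Set.indicator_of_notMem h])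
    rw [Function.mem_support, hH]; dsimp only
    rw [Set.indicator_of_mem hzT]
    refine mul_ne_zero hJne (mul_ne_zero hΦC (Real.exp_pos _).ne')
  -- the normalised fibre integral of the row is a positive multiple of `∫ H dμ₀`
  set κ : ℝ := Real.exp (-((lσ + dg * Real.log ((T3Scales F γ hγ hγ1' K).gk k)) * N)) with hκ
  have hGH : ∀ U', Real.exp (-(q V U')) * (((Real.exp (-((lσ + dg * Real.log ((T3Scales F γ hγ hγ1' K).gk k)) * N)) * T.indicator (fun z => (J z : ℝ)) (V, U')) *
              wt (Φ (V, U')) *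
              Real.exp (-((towerOfAC 𝔠.lane X 𝔖).mainT k (Hist.triv (F.P K) k) (Φ (V, U')) -
                    (towerOfAC 𝔠.lane X 𝔖).mainT (k + 1) (Hist.triv (F.P K) (k + 1)) V)
                + ((towerOfAC 𝔠.lane X 𝔖).Pint k (Hist.triv (F.P K) k) (Φ (V, U')) - (piecesAC 𝔠.lane X 𝔖 k).Pold (Hist.triv (F.P K) (k + 1)) V)
                + q V U'))) = κ * H U' := fun U' => by
    rw [hH, hw, hκ]; dsimp only
    have e : Real.exp (-((towerOfAC 𝔠.lane X 𝔖).mainT k (Hist.triv (F.P K) k) (Φ (V, U')) - m₁)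
          + ((towerOfAC 𝔠.lane X 𝔖).Pint k (Hist.triv (F.P K) k) (Φ (V, U')) - Po) + q V U')
        = Real.exp (-((towerOfAC 𝔠.lane X 𝔖).mainT k (Hist.triv (F.P K) k) (Φ (V, U')))
            + (towerOfAC 𝔠.lane X 𝔖).Pint k (Hist.triv (F.P K) k) (Φ (V, U')) + (m₁ - Po)) * Real.exp (q V U') := by
      rw [← Real.exp_add]; congr 1; ring
    rw [e]
    have e2 : Real.exp (-(q V U')) * Real.exp (q V U') = 1 := by rw [← Real.exp_add, neg_add_cancel, Real.exp_zero]
    calc _ = κ * (T.indicator (fun z => (J z : ℝ)) (V, U') * (χ₀ (Φ (V, U')) *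
            Real.exp (-((towerOfAC 𝔠.lane X 𝔖).mainT k (Hist.triv (F.P K) k) (Φ (V, U')))
              + (towerOfAC 𝔠.lane X 𝔖).Pint k (Hist.triv (F.P K) k) (Φ (V, U')) + (m₁ - Po)))) *
            (Real.exp (-(q V U')) * Real.exp (q V U')) := by rw [hκ, hχ₀]; ring
      _ = _ := by rw [e2, mul_one]
  have hrel := integral_exp_neg_mul_eq (vol := μ₀) (hqm V) (hZ V) (fun U' => ((Real.exp (-((lσ + dg * Real.log ((T3Scales F γ hγ hγ1' K).gk k)) * N)) * T.indicator (fun z => (J z : ℝ)) (V, U')) *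
              wt (Φ (V, U')) *
              Real.exp (-((towerOfAC 𝔠.lane X 𝔖).mainT k (Hist.triv (F.P K) k) (Φ (V, U')) -
                    (towerOfAC 𝔠.lane X 𝔖).mainT (k + 1) (Hist.triv (F.P K) (k + 1)) V)
                + ((towerOfAC 𝔠.lane X 𝔖).Pint k (Hist.triv (F.P K) k) (Φ (V, U')) - (piecesAC 𝔠.lane X 𝔖 k).Pold (Hist.triv (F.P K) (k + 1)) V)
                + q V U')))
  have hlhs : ∫ U', Real.exp (-(q V U')) * (((Real.exp (-((lσ + dg * Real.log ((T3Scales F γ hγ hγ1' K).gk k)) * N)) * T.indicator (fun z => (J z : ℝ)) (V, U')) *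
              wt (Φ (V, U')) *
              Real.exp (-((towerOfAC 𝔠.lane X 𝔖).mainT k (Hist.triv (F.P K) k) (Φ (V, U')) -
                    (towerOfAC 𝔠.lane X 𝔖).mainT (k + 1) (Hist.triv (F.P K) (k + 1)) V)
                + ((towerOfAC 𝔠.lane X 𝔖).Pint k (Hist.triv (F.P K) k) (Φ (V, U')) - (piecesAC 𝔠.lane X 𝔖 k).Pold (Hist.triv (F.P K) (k + 1)) V)
                + q V U'))) ∂μ₀ = κ * ∫ U', H U' ∂μ₀ := by
    rw [← integral_const_mul]; exact integral_congr_ae (Filter.Eventually.of_forall hGH)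
  have hκ0 : 0 < κ := Real.exp_pos _
  have hprod : 0 < partZ μ₀ (q V) * ∫ U', ((Real.exp (-((lσ + dg * Real.log ((T3Scales F γ hγ hγ1' K).gk k)) * N)) * T.indicator (fun z => (J z : ℝ)) (V, U')) *
              wt (Φ (V, U')) *
              Real.exp (-((towerOfAC 𝔠.lane X 𝔖).mainT k (Hist.triv (F.P K) k) (Φ (V, U')) -
                    (towerOfAC 𝔠.lane X 𝔖).mainT (k + 1) (Hist.triv (F.P K) (k + 1)) V)
                + ((towerOfAC 𝔠.lane X 𝔖).Pint k (Hist.triv (F.P K) k) (Φ (V, U')) - (piecesAC 𝔠.lane X 𝔖 k).Pold (Hist.triv (F.P K) (k + 1)) V)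
                + q V U')) ∂(normalized μ₀ (q V)) := by
    rw [← hrel, hlhs]; exact mul_pos hκ0 hHpos
  exact lt_of_mul_lt_mul_left (by rw [mul_zero]; exact hprod) (hZ V).le


/-- ★★★ **THE `wt`-WEIGHTED LOWER ROW AT THE T³ RECORD WITH THE CHARGING LETTER** — ✓`fibre57LowOnAC_T3_of_le_gamma_of_hcharge` VERBATIM with the abstract weight (`hpos ↦ (hlom₁, hcharge)` on the
charging set `O_ε ∩ {wt ≠ 0}`).  The lower pin of any (R7) repair — `wt = χB·𝟙[loPrintAC k]` (R7a∕R7d, print's χ_k), `wt = χB·𝟙[chiMinAC (max B₃ 1) k]` (R7c) — docks here; for the first,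
`hcharge` is ✓`hcharge_loPrintAC_of_floor` (door 3) and `hloinv` is ✓`hloinv_loPrintAC_of_uniqueMinOrbit` (door 1). [cite: Balaban1985UV3, (37) p.265 + (47) p.267 + (55)–(58) pp.269–270 + p.272 L32–33] -/
theorem fibre57LowOnAC_T3_of_le_gamma_of_hcharge_weight (hγs : γ ≤ ((((4500 : ℝ) * (F.L : ℝ) ^ 5)⁻¹ / (𝔠.b₀ * Q0 𝔠.p₀)) ^ 2) ^ 2)
    (lo : (k : ℕ) → Set (GaugeField (F.P K) k (Matrix.specialUnitaryGroup (Fin 2) ℂ))) (k : ℕ) (hk : k ≤ K)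
    (hav : (X.av k).avg = avgFun (expMeanLogSU (n := Fin 2)))
    (Φ : GaugeField (F.P K) (k + 1) (Matrix.specialUnitaryGroup (Fin 2) ℂ) × GaugeField (F.P K) k (Matrix.specialUnitaryGroup (Fin 2) ℂ) →
      GaugeField (F.P K) k (Matrix.specialUnitaryGroup (Fin 2) ℂ))
    (J : GaugeField (F.P K) (k + 1) (Matrix.specialUnitaryGroup (Fin 2) ℂ) × GaugeField (F.P K) k (Matrix.specialUnitaryGroup (Fin 2) ℂ) → ℝ≥0)
    (T : Set (GaugeField (F.P K) (k + 1) (Matrix.specialUnitaryGroup (Fin 2) ℂ) × GaugeField (F.P K) k (Matrix.specialUnitaryGroup (Fin 2) ℂ)))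
    (hΦ : Measurable Φ) (hJ : Measurable J) (hT : MeasurableSet T)
    (hmap : ((((fieldMeasure (F.P K) (k + 1) (Matrix.specialUnitaryGroup (Fin 2) ℂ)).prod
        (fieldMeasure (F.P K) k (Matrix.specialUnitaryGroup (Fin 2) ℂ))).restrict T).withDensity (fun z => (J z : ℝ≥0∞))).map Φ =
      (fieldMeasure (F.P K) k (Matrix.specialUnitaryGroup (Fin 2) ℂ)).restrict
        {U : GaugeField (F.P K) k (Matrix.specialUnitaryGroup (Fin 2) ℂ) |
          ∀ c i, dist1 (loopHol U c i) < ((Fintype.card (Idx (F.P K)) : ℝ))⁻¹ / 10})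
    (hfib : ∀ z ∈ T, avgFun (expMeanLogSU (n := Fin 2)) (Φ z) = z.1) (N lσ dg : ℝ)
    (q : GaugeField (F.P K) (k + 1) (Matrix.specialUnitaryGroup (Fin 2) ℂ) → GaugeField (F.P K) k (Matrix.specialUnitaryGroup (Fin 2) ℂ) → ℝ)
    (hqm : ∀ V, Measurable (q V)) (hZ : ∀ V, 0 < partZ (fieldMeasure (F.P K) k (Matrix.specialUnitaryGroup (Fin 2) ℂ)) (q V))
    (hU : Measurable (X.UkH k (Hist.triv (F.P K) k))) (hPm : Measurable ((inputOfAC 𝔠.lane X 𝔖).Pint k (Hist.triv (F.P K) k)))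
    (cP : ℝ) (hPb : ∀ U, (inputOfAC 𝔠.lane X 𝔖).Pint k (Hist.triv (F.P K) k) U ≤ cP)
    (hinv : GaugeInvariant (fun U : GaugeField (F.P K) k (Matrix.specialUnitaryGroup (Fin 2) ℂ) =>
      Real.exp (-((towerOfAC 𝔠.lane X 𝔖).mainT k (Hist.triv (F.P K) k) U) + (towerOfAC 𝔠.lane X 𝔖).Pint k (Hist.triv (F.P K) k) U)))
    (hlom : MeasurableSet (lo k))
    (hloinv : ∀ (u : GaugeTransf (F.P K) k (Matrix.specialUnitaryGroup (Fin 2) ℂ)) (U : GaugeField (F.P K) k (Matrix.specialUnitaryGroup (Fin 2) ℂ)),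
      gaugeAct u U ∈ lo k ↔ U ∈ lo k)
    (wt : GaugeField (F.P K) k (Matrix.specialUnitaryGroup (Fin 2) ℂ) → ℝ) (hwtm : Measurable wt) (hwt0 : ∀ U, 0 ≤ wt U) (hwt1 : ∀ U, wt U ≤ 1)
    (hwtinv : GaugeInvariant wt)
    (hwtχ : ∀ U : GaugeField (F.P K) k (Matrix.specialUnitaryGroup (Fin 2) ℂ), wt U ≠ 0 →
      chiB 𝔠.lane.carrier.M₁ (rcolOf (T3Scales F γ hγ hγ1' K) 𝔠.lane.carrier) (eps1Of (T3Scales F γ hγ hγ1' K) 𝔠.lane.carrier) k (Hist.triv (F.P K) (k + 1)) U ≠ 0)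
    (hwtlo : ∀ U : GaugeField (F.P K) k (Matrix.specialUnitaryGroup (Fin 2) ℂ), wt U ≠ 0 → U ∈ lo k)
    (hσ : (piecesAC 𝔠.lane X 𝔖 k).logσ₀ = lσ) (hdg : (piecesAC 𝔠.lane X 𝔖 k).dg = dg)
    (hstar : (piecesAC 𝔠.lane X 𝔖 k).starB (Hist.triv (F.P K) (k + 1)) = N)
    (hZU : ∀ V, (piecesAC 𝔠.lane X 𝔖 k).logZU (Hist.triv (F.P K) (k + 1)) V =
      Real.log (partZ (fieldMeasure (F.P K) k (Matrix.specialUnitaryGroup (Fin 2) ℂ)) (q V)))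
    (hFl : ∀ V, (piecesAC 𝔠.lane X 𝔖 k).logFl (Hist.triv (F.P K) (k + 1)) V =
      Real.log (∫ U', (Real.exp (-((lσ + dg * Real.log ((T3Scales F γ hγ hγ1' K).gk k)) * N)) * T.indicator (fun z => (J z : ℝ)) (V, U')) *
              wt (Φ (V, U')) *
              Real.exp (-((towerOfAC 𝔠.lane X 𝔖).mainT k (Hist.triv (F.P K) k) (Φ (V, U')) -
                    (towerOfAC 𝔠.lane X 𝔖).mainT (k + 1) (Hist.triv (F.P K) (k + 1)) V)
                + ((towerOfAC 𝔠.lane X 𝔖).Pint k (Hist.triv (F.P K) k) (Φ (V, U')) - (piecesAC 𝔠.lane X 𝔖 k).Pold (Hist.triv (F.P K) (k + 1)) V)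
                + q V U')
            ∂(normalized (fieldMeasure (F.P K) k (Matrix.specialUnitaryGroup (Fin 2) ℂ)) (q V))))
    (hlom₁ : MeasurableSet (lo (k + 1)))
    (hcharge : ∀ Nset : Set (GaugeField (F.P K) (k + 1) (Matrix.specialUnitaryGroup (Fin 2) ℂ)), MeasurableSet Nset → Nset ⊆ lo (k + 1) →
      fieldMeasure (F.P K) k (Matrix.specialUnitaryGroup (Fin 2) ℂ)
        ({U : GaugeField (F.P K) k (Matrix.specialUnitaryGroup (Fin 2) ℂ) | ∀ c i, dist1 (loopHol U c i) < ((Fintype.card (Idx (F.P K)) : ℝ))⁻¹ / 10} ∩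
          {U | wt U ≠ 0} ∩
          (avgFun (expMeanLogSU (n := Fin 2))) ⁻¹' Nset) = 0 →
      fieldMeasure (F.P K) (k + 1) (Matrix.specialUnitaryGroup (Fin 2) ℂ) Nset = 0) :
    Fibre57LowOnAC 𝔠.lane X 𝔖 lo k :=
  fibre57LowOnAC_T3_of_le_gamma_of_ae_pos_weight 𝔠 X 𝔖 hγs lo k hk hav Φ J T hΦ hJ hT hmap hfib N lσ dg q hqm hZ hU hPm cP hPb hinv hlom hloinv
    wt hwtm hwt0 hwt1 hwtinv hwtχ hwtlo hσ hdg hstar hZU hFl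
    (hpos_ae_of_hcharge_weight 𝔠 X 𝔖 lo k Φ J T hΦ hJ hT hmap hfib N lσ dg q hqm hZ hU hPm cP hPb hinv wt hwtm hwt0 hwt1 hwtinv hlom₁ hcharge)

end Summit.QuantumFields.YangMills.Theorems.PinnedStepTrivPins

end
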